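/-
Copyright (c) 2026 the pub-hodgecm-mathlib formalisation cell (harness21).  Prover seat hodgecm-mathlib-K2E3-p36 (g3), HCML Track B «K2-LIT» ∕ h413
(`stmt-HodgeConjecture-24833`), R90-TF section S3, (U3-F) assembly brick B12 «the DYADIC READING of the planted root» (captain K2E3-p17 (g11) brick table
01:29:11Z, item (T2); taken by name 01:29:44Z).  2026-09-05.
-/
import Mathlib.NumberTheory.NumberField.Basic
import Mathlib.RingTheory.DedekindDomain.AdicValuation
import Mathlib.RingTheory.Polynomial.Tower
import Mathlib.NumberTheory.Padics.RingHoms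
import HarnessLib

/-!
# R90-TF · S3 · THEOREMS — `R90S3DyadicRootReading` ((U3-F) assembly, brick B12): a root `α` of a monic `g ∈ ℤ[X]` with `g ≡ ∏ (X − rᵢ) (mod 2^M)`,
# `rᵢ ≡ 1 (mod 4)` in `ℤ₂`, `M ≥ 2·deg`, satisfies `|(α − 1)∕4|_u ≤ 1` at EVERY dyadic place `u` of any number field containing it

R90-TF section S3; crux H413 (`stmt-HodgeConjecture-24833`, lane `--supports … --as helper`), route `HCCMUnconditional`.  Brick B12 of the (U3-F) assembly behind
`stub_R90_S3_auxGlobaliseField`: the supplier of the hypothesis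
`hα2 : ∀ u, (2 : 𝓞 F) ∈ u.asIdeal → u.valuation F ((α − 1) ∕ 4) ≤ 1` of ★ P8d `isUnramifiedAt_of_planted_of_dyadic` (`R90S3PlantedDyadicData`) from the dyadic
congruence `g ≡ ∏ (X − C rᵢ) (mod 2^M)`, `4 ∣ rᵢ − 1`, delivered by ★ B4b-inst `exists_planted_targetList` (`R90S3PlantingTargetList`).  HEAD (§3
**`exists_dyadicPrecision`**, the captain's tokens): for `r : Fin d → ℤ₂` with `4 ∣ rᵢ − 1` and `d ≠ 0` there is `M₀` (namely `2d`) such that for all `M ≥ M₀`, every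
monic `g ∈ ℤ[X]` with `g mod 2^M = ∏ (X − rᵢ) mod 2^M`, every number field `F`, every root `α ∈ F` of `g` and every place `u ∋ 2`: `|(α − 1)∕4|_u ≤ 1`.
PURELY ALGEBRAIC (no completion, no `ℚ₂`-structure, no Krasner): Mathlib-only imports; THEOREMS ONLY (no `def`, no `instance`, no notation, no named fact,
no `sorry`); never imports `Cruxes/…/Lines`.  The injectivity of `r` and the degree of `g` in the captain's head are idle (kept for the consumer's call shape;
the workhorse §2 omits them).

THE MATHEMATICS [folklore].  (§1) With `aᵢ := (rᵢ mod 2^M) ∈ ℕ` one has `∏ (X − rᵢ) ≡ ∏ (X − aᵢ) (mod 2^M)`, so every coefficient of `g − ∏ (X − aᵢ)` is divisible by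
`2^M` (Mathlib `ZMod.intCast_zmod_eq_zero_iff_dvd`) and `g = ∏ (X − aᵢ) + 2^M·h` in `ℤ[X]` (Mathlib `Polynomial.C_dvd_iff_dvd_coeff`); `aᵢ ≡ rᵢ ≡ 1 (mod 4)` for `M ≥ 2`
(Mathlib `PadicInt.cast_toZModPow`).  (§2) Let `v = | · |_u`, `u ∋ 2`, so `v(2) < 1`; `α` is integral (root of the monic `g`), hence `v(α) ≤ 1` and `v(h(α)) ≤ 1`;
`v(aᵢ − 1) ≤ v(4)`.  If `v(α − 1) > v(4)` then `v(α − aᵢ) = v((α − 1) − (aᵢ − 1)) = v(α − 1)` for every `i` (ultrametric), so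
`v(4)^d < v(α − 1)^d = v(∏ (α − aᵢ)) = v(−2^M h(α)) ≤ v(2)^M ≤ v(2)^{2d} = v(4)^d`, absurd.  Hence `v(α − 1) ≤ v(4)`, i.e. `v((α − 1)∕4) ≤ 1`.

HONEST LABEL: HC_CM is proved only modulo the 7 printed citations (2 remaining named inputs: hLiu418 = stmt-HodgeConjecture-24832, h413 =
stmt-HodgeConjecture-24833) until rung 0 closes; elementary algebra for a sub-step of a GENUINE residual ((U3-F)); proves nothing printed; count-neutral.
References: [NeukirchANT1999] Ch. II (8.2)–(8.4); [Serre1979] Ch. II §5.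
-/

set_option autoImplicit false
-- the mandated namespace repeats the single-problem summit's segment (`HodgeConjecture.HodgeConjecture`)
set_option linter.dupNamespace false

noncomputable section

namespace Summit.HodgeConjecture.HodgeConjecture.R90.S3

open Polynomial IsDedekindDomain NumberField

/-! ## §1 From `g ≡ ∏ (X − rᵢ) (mod 2^M)` over `ℤ₂` to `g = ∏ (X − aᵢ) + 2^M · h` in `ℤ[X]`, `aᵢ ≡ 1 (mod 4)` -/

section IntegerModel

/-- **Integer model of the dyadic target.**  If `g ≡ ∏ (X − rᵢ) (mod 2^M)` (the currency of ★ `exists_planted_targetList`), then with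
`aᵢ := (toZModPow M rᵢ).val ∈ ℕ` one has `g = ∏ (X − aᵢ) + 2^M · h` for some `h ∈ ℤ[X]`. [folklore] -/
theorem exists_eq_prod_add_pow_mul {d M : ℕ} (r : Fin d → ℤ_[2]) (g : ℤ[X])
    (hg : g.map (Int.castRingHom (ZMod (2 ^ M))) = (∏ i, (X - C (r i))).map (PadicInt.toZModPow M)) :
    ∃ h : ℤ[X], g = (∏ i, (X - C ((PadicInt.toZModPow M (r i)).val : ℤ))) + C ((2 : ℤ) ^ M) * h := by
  set f : ℤ[X] := ∏ i, (X - C ((PadicInt.toZModPow M (r i)).val : ℤ)) with hf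
  -- both sides reduce to `∏ (X − C (rᵢ mod 2^M))`
  have hfg : (g - f).map (Int.castRingHom (ZMod (2 ^ M))) = 0 := by
    rw [Polynomial.map_sub, hg, hf, Polynomial.map_prod, Polynomial.map_prod, sub_eq_zero]
    refine Finset.prod_congr rfl fun i _ => ?_
    rw [Polynomial.map_sub, Polynomial.map_sub, map_X, map_X, map_C, map_C, eq_intCast, Int.cast_natCast, ZMod.natCast_zmod_val]
  have hdvd : C ((2 : ℤ) ^ M) ∣ g - f := by
    rw [C_dvd_iff_dvd_coeff]
    intro n
    have hn : (((g - f).coeff n : ℤ) : ZMod (2 ^ M)) = 0 := by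
      have := congrArg (fun q => q.coeff n) hfg
      simpa only [coeff_map, eq_intCast, coeff_zero] using this
    exact_mod_cast (ZMod.intCast_zmod_eq_zero_iff_dvd _ _).1 hn
  obtain ⟨h, hh⟩ := hdvd
  exact ⟨h, by rw [← hh]; ring⟩

/-- `rᵢ ≡ 1 (mod 4)` in `ℤ₂` and `M ≥ 2` ⟹ the integer `aᵢ := (toZModPow M rᵢ).val` is `≡ 1 (mod 4)` (Mathlib `PadicInt.ker_toZModPow`, `PadicInt.cast_toZModPow`).
[folklore] -/
theorem four_dvd_val_toZModPow_sub_one {x : ℤ_[2]} (hx : (4 : ℤ_[2]) ∣ x - 1) {M : ℕ} (hM : 2 ≤ M) :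
    (4 : ℤ) ∣ ((PadicInt.toZModPow M x).val : ℤ) - 1 := by
  -- `x ≡ 1 (mod 4)` read through `toZModPow 2`
  have h2 : PadicInt.toZModPow 2 x = 1 := by
    rw [← sub_eq_zero, ← map_one (PadicInt.toZModPow 2 : ℤ_[2] →+* ZMod (2 ^ 2)), ← map_sub, ← RingHom.mem_ker,
      PadicInt.ker_toZModPow, Ideal.mem_span_singleton]
    norm_num
    exact hx
  -- … and through `toZModPow M`
  have hval : (((PadicInt.toZModPow M x).val : ℕ) : ZMod (2 ^ 2)) = 1 := by
    rw [← ZMod.cast_eq_val, PadicInt.cast_toZModPow 2 M hM x, h2]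
  have hval' : (((PadicInt.toZModPow M x).val : ℤ) : ZMod (2 ^ 2)) = ((1 : ℤ) : ZMod (2 ^ 2)) := by
    rw [Int.cast_natCast, hval, Int.cast_one]
  have := (ZMod.intCast_eq_intCast_iff_dvd_sub _ _ _).1 hval'.symm
  exact_mod_cast this

end IntegerModel

/-! ## §2 The workhorse: `|(α − 1)∕4|_u ≤ 1` from the integer model -/

section Reading

/-- **THE DYADIC READING (workhorse).**  `g = ∏_{i<d} (X − aᵢ) + 2^M·h` in `ℤ[X]` with `aᵢ ≡ 1 (mod 4)`, `d ≠ 0`, `M ≥ 2d`, `g` monic; `α` a root of `g` in a number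
field `F`, `u` a place of `F` containing `2`.  Then `|(α − 1)∕4|_u ≤ 1`.  (If `|α − 1| > |4|` then `|α − aᵢ| = |α − 1|` for every `i`, whence
`|4|^d < |α − 1|^d = |∏ (α − aᵢ)| = |2^M h(α)| ≤ |2|^M ≤ |4|^d` — `α` and `h(α)` being integral.) [folklore] -/
theorem valuation_sub_one_div_four_le_one_of_eq_prod_add {d M : ℕ} (hd : d ≠ 0) (hM : 2 * d ≤ M) (a : Fin d → ℤ)
    (ha : ∀ i, (4 : ℤ) ∣ a i - 1) {g h : ℤ[X]} (hgm : g.Monic) (hg : g = (∏ i, (X - C (a i))) + C ((2 : ℤ) ^ M) * h)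
    {F : Type} [Field F] [NumberField F] {α : F} (hα : aeval α g = 0) (u : HeightOneSpectrum (𝓞 F)) (hu : (2 : 𝓞 F) ∈ u.asIdeal) :
    u.valuation F ((α - 1) / 4) ≤ 1 := by
  -- integrality: `α ∈ 𝓞 F`; elements of `𝓞 F` (integers, `h(α)`) have `| · |_u ≤ 1`; `|2|_u < 1`
  have hint : IsIntegral ℤ α := ⟨g, hgm, by rwa [← aeval_def]⟩
  set α₀ : 𝓞 F := ⟨α, (mem_integralClosure_iff ℤ F).2 hint⟩ with hα₀
  have hOle : ∀ x : 𝓞 F, u.valuation F (x : F) ≤ 1 := fun x => by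
    rw [RingOfIntegers.coe_eq_algebraMap]; exact HeightOneSpectrum.valuation_le_one u x
  have hZle : ∀ n : ℤ, u.valuation F (n : F) ≤ 1 := fun n => by
    have := hOle n
    rwa [RingOfIntegers.coe_eq_algebraMap, map_intCast] at this
  have hhα : u.valuation F (aeval α h) ≤ 1 := by
    have hco : aeval α h = algebraMap (𝓞 F) F (aeval α₀ h) := by rw [← aeval_algebraMap_apply]; rfl
    rw [hco]; exact HeightOneSpectrum.valuation_le_one u _
  have h2lt : u.valuation F (2 : F) < 1 := by
    have h2 : u.valuation F (algebraMap (𝓞 F) F 2) < 1 := (HeightOneSpectrum.valuation_lt_one_iff_mem (K := F) (v := u) (2 : 𝓞 F)).2 hu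
    rwa [map_ofNat] at h2
  have h4pos : 0 < u.valuation F (4 : F) := zero_lt_iff.2 ((Valuation.ne_zero_iff _).2 (by norm_num))
  -- `|aᵢ − 1| ≤ |4|`
  have hai : ∀ i, u.valuation F ((a i : F) - 1) ≤ u.valuation F (4 : F) := fun i => by
    obtain ⟨b, hb⟩ := ha i
    have hbF : ((a i : F) - 1) = 4 * (b : F) := by exact_mod_cast congrArg (Int.cast : ℤ → F) hb
    rw [hbF, map_mul]
    exact mul_le_of_le_one_right' (hZle b)
  -- suppose `|α − 1| > |4|`
  by_contra hlt1
  rw [not_le] at hlt1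
  have hlt : u.valuation F (4 : F) < u.valuation F (α - 1) := by
    have hmul := mul_lt_mul_of_pos_right hlt1 h4pos
    rwa [one_mul, ← map_mul, div_mul_cancel₀ _ (by norm_num : (4 : F) ≠ 0)] at hmul
  -- then every `|α − aᵢ| = |α − 1|`
  have hfac : ∀ i, u.valuation F (α - (a i : F)) = u.valuation F (α - 1) := fun i => by
    rw [show α - (a i : F) = (α - 1) - ((a i : F) - 1) by ring]
    exact Valuation.map_sub_eq_of_lt_left _ ((hai i).trans_lt hlt)
  have hprod : u.valuation F (∏ i, (α - (a i : F))) = u.valuation F (α - 1) ^ d := by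
    rw [map_prod, Finset.prod_congr rfl fun i _ => hfac i, Finset.prod_const, Finset.card_univ, Fintype.card_fin]
  -- `∏ (α − aᵢ) = −2^M h(α)`
  have heval : ∏ i, (α - (a i : F)) = -(2 ^ M * aeval α h) := by
    have h0 : aeval α g = (∏ i, (α - (a i : F))) + 2 ^ M * aeval α h := by
      rw [hg]
      simp only [map_add, map_mul, _root_.map_prod, map_sub, aeval_X, map_intCast, map_pow, map_ofNat, eq_intCast]
    rw [hα] at h0
    exact eq_neg_of_add_eq_zero_left h0.symm
  -- the chain `|α − 1|^d ≤ |2|^M ≤ |4|^d < |α − 1|^d`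
  have h2d : u.valuation F (2 : F) ^ M ≤ u.valuation F (4 : F) ^ d :=
    calc u.valuation F (2 : F) ^ M ≤ u.valuation F (2 : F) ^ (2 * d) := pow_le_pow_right_of_le_one' h2lt.le hM
      _ = u.valuation F (4 : F) ^ d := by rw [pow_mul, ← map_pow]; norm_num
  have key : u.valuation F (α - 1) ^ d ≤ u.valuation F (4 : F) ^ d :=
    calc u.valuation F (α - 1) ^ d = u.valuation F (∏ i, (α - (a i : F))) := hprod.symm
      _ = u.valuation F (2 : F) ^ M * u.valuation F (aeval α h) := by rw [heval, Valuation.map_neg, map_mul, map_pow]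
      _ ≤ u.valuation F (2 : F) ^ M := mul_le_of_le_one_right' hhα
      _ ≤ u.valuation F (4 : F) ^ d := h2d
  exact absurd key (not_le.2 (pow_lt_pow_left₀ hlt h4pos.le hd))

end Reading

/-! ## §3 HEAD: the dyadic precision `M₀ := 2d` -/

section Head

/-- **B12 — DYADIC READING OF THE PLANTED ROOT (clean form).**  For `r : Fin d → ℤ₂` with `4 ∣ rᵢ − 1` and `d ≠ 0`: for every `M ≥ 2d`, every monic `g ∈ ℤ[X]`
with `g mod 2^M = ∏ (X − rᵢ) mod 2^M` (★ `exists_planted_targetList`'s dyadic clause), every number field `F`, every root `α ∈ F` of `g` and every place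
`u ∋ 2` of `F`: `|(α − 1)∕4|_u ≤ 1` — the hypothesis `hα2` of ★ P8d `isUnramifiedAt_of_planted_of_dyadic`. (§1 + §2.) [cite: NeukirchANT1999, Ch. II (8.2)-(8.4)] -/
theorem valuation_sub_one_div_four_le_one_of_map_eq {d : ℕ} (r : Fin d → ℤ_[2]) (hr4 : ∀ i, (4 : ℤ_[2]) ∣ r i - 1) (hd : d ≠ 0)
    {M : ℕ} (hM : 2 * d ≤ M) {g : ℤ[X]} (hgm : g.Monic)
    (hg : g.map (Int.castRingHom (ZMod (2 ^ M))) = (∏ i, (X - C (r i))).map (PadicInt.toZModPow M))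
    {F : Type} [Field F] [NumberField F] {α : F} (hα : aeval α g = 0) (u : HeightOneSpectrum (𝓞 F)) (hu : (2 : 𝓞 F) ∈ u.asIdeal) :
    u.valuation F ((α - 1) / 4) ≤ 1 := by
  obtain ⟨h, hh⟩ := exists_eq_prod_add_pow_mul r g hg
  have hM2 : 2 ≤ M := le_trans (by omega) hM
  exact valuation_sub_one_div_four_le_one_of_eq_prod_add hd hM (fun i => ((PadicInt.toZModPow M (r i)).val : ℤ))
    (fun i => four_dvd_val_toZModPow_sub_one (hr4 i) hM2) hgm hh hα u hu

/-- **B12 HEAD — `exists_dyadicPrecision`** (the captain's tokens, brick table 01:29:11Z (T2)): for `r : Fin d → ℤ₂` injective with `4 ∣ rᵢ − 1` and `d ≠ 0`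
there is `M₀` such that for all `M ≥ M₀`, every monic `g ∈ ℤ[X]` of degree `d` with `g mod 2^M = ∏ (X − rᵢ) mod 2^M`, every number field `F`, every root
`α ∈ F` of `g` and every `u ∋ 2`: `u.valuation F ((α − 1) ∕ 4) ≤ 1`.  (`M₀ := 2d`; injectivity and the degree clause are not used.)
[cite: NeukirchANT1999, Ch. II (8.2)-(8.4)] -/
theorem exists_dyadicPrecision {d : ℕ} (r : Fin d → ℤ_[2]) (_hri : Function.Injective r) (hr4 : ∀ i, (4 : ℤ_[2]) ∣ r i - 1) (hd : d ≠ 0) :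
    ∃ M₀ : ℕ, ∀ M, M₀ ≤ M → ∀ g : ℤ[X], g.Monic → g.natDegree = d →
      g.map (Int.castRingHom (ZMod (2 ^ M))) = (∏ i, (X - C (r i))).map (PadicInt.toZModPow M) →
      ∀ (F : Type) [Field F] [NumberField F] (α : F), aeval α g = 0 →
        ∀ u : HeightOneSpectrum (𝓞 F), (2 : 𝓞 F) ∈ u.asIdeal → u.valuation F ((α - 1) / 4) ≤ 1 :=
  ⟨2 * d, fun _ hM _ hgm _ hg _ _ _ _ hα u hu => valuation_sub_one_div_four_le_one_of_map_eq r hr4 hd hM hgm hg hα u hu⟩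

end Head

end Summit.HodgeConjecture.HodgeConjecture.R90.S3

end
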